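import Mathlib
import Summits.Ventures.DiscreteObjects.Mahler.CensusAuxCircleCheckA

/-!
# Kernel checker for the one-variable circle claims, part B: cells, segments, soundness (venture `DiscreteObjects`, target L)

Cell `pub-namedobj`, seat `pub-namedobj-mahler-g15`. Framing: lottery ticket; floor = certified bounds/negative
ranges.

A COMPUTABLE checker, evaluated by `decide` with kernel reduction, for the statement `CircleClaim P gs m` of
`CensusAuxCirclePoly` (`-m ≤ P(w) - Σ_g f_g log G_g(w)` on `[-2, 2]` wherever all `G_g(w) > 0`; `P`, `G_g` rational
coefficient lists, `f_g ≥ 0`), and its soundness `circleClaim_of_segCheck`.  A certificate is a list of CELLS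
`(w₀, h, hints)` covering `[-2, 2]` (`coverFrom`); on a cell, with `δ = w - w₀`, `|δ| ≤ h`:

* `P(w₀ + δ)` is the exact Taylor shift (part A, `taylorShift`);
* for each `g`: `G(w₀ + δ) = g₀ (1 + y(δ))` with `g₀ = G(w₀) > 0` and `y = relPoly` (zero constant term);
  `log g₀ ≤ logUBh g₀ s` with the reduction exponent `s` supplied as a HINT (any `s` is sound);
  `log(1 + y) ≤ y` always (`Real.log_le_sub_one_of_pos`), and when `Σ_i |y_i| h^i = η ≤ 1/2` the sharper
  `log(1 + y) ≤ y - y²/2 + η³/(1 - η)` (part A, `log_one_add_le_cubic`) with `y² ≥ y₁²δ² - 2|y₁| h τ`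
  (`τ = h² Σ_{i≥2} |y_i| h^{i-2}` bounds `|y - y₁δ|`)  — `logTermLB`;
* the resulting polynomial lower bound `L(δ) + K` (`cellPoly`) is minimised over `|δ| ≤ h` by `polyLB` (part A).

Segments: `SegClaim P gs m lo hi` restricts `w` to `[lo, hi]`, so that a certificate can be split over several `decide`
theorems (`segClaim_append`, `circleClaim_of_segClaim`).  No `native_decide`.
-/

namespace Summit.Ventures.DiscreteObjects.Mahler

/-! ## One logarithmic term on a cell -/

/-- The polynomial `y(δ)` with `G(w₀ + δ) = g₀ (1 + y(δ))`, `y(0) = 0`, from the shifted list `Gs = g₀ :: T`. -/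
def relPoly (Gs : List ℚ) : List ℚ := 0 :: lSMul (Gs.headD 0)⁻¹ Gs.tail

/-- `G(w₀ + δ) = g₀ · (1 + y(δ))` for `g₀ ≠ 0`. -/
theorem qeval_relPoly (Gs : List ℚ) (hg : Gs.headD 0 ≠ 0) (δ : ℝ) :
    qeval Gs δ = (Gs.headD 0 : ℝ) * (1 + qeval (relPoly Gs) δ) := by
  cases Gs with
  | nil => simp at hg
  | cons g T =>
    simp only [List.headD_cons] at hg ⊢
    rw [relPoly, qeval_cons, qeval_cons, List.headD_cons, List.tail_cons, qeval_lSMul]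
    have hg' : (g : ℝ) ≠ 0 := by exact_mod_cast hg
    push_cast
    field_simp
    ring

/-- A list with zero constant term evaluates as `y₁ δ + δ² · tail(δ)`. -/
theorem qeval_zero_head (Y : List ℚ) (h0 : Y.headD 0 = 0) (δ : ℝ) :
    qeval Y δ = (Y.getD 1 0 : ℝ) * δ + δ ^ 2 * qeval (Y.drop 2) δ := by
  match Y with
  | [] => simp
  | [a] => simp only [List.headD_cons] at h0; subst h0; simp
  | a :: b :: T => simp only [List.headD_cons] at h0; subst h0; simp; ring

/-- Lower bound data `(L, K)` for `-f · log G(w₀ + δ)` on the cell: `-f log G(w₀+δ) ≥ L(δ) + K`.  `none` if `G(w₀) ≤ 0`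
or `f < 0`. -/
def logTermLB (G : List ℚ) (f w0 h : ℚ) (s : ℤ) : Option (List ℚ × ℚ) :=
  let Gs := taylorShift w0 G
  let g0 := Gs.headD 0
  if 0 < g0 ∧ 0 ≤ f then
    let Y := relPoly Gs
    let η := absBound Y h
    if η ≤ 1 / 2 then
      let y1 := Y.getD 1 0
      let τ := h ^ 2 * absBound (Y.drop 2) h
      some (lAdd (lSMul (-f) Y) [0, 0, f / 2 * y1 ^ 2],
        -(f * logUBh g0 s) - f * qabs y1 * h * τ - f * (η ^ 3 / (1 - η)))
    else some (lSMul (-f) Y, -(f * logUBh g0 s))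
  else none

/-- Common facts for the soundness of `logTermLB` (with `Gs = taylorShift w₀ G`, `Y = relPoly Gs`, `g₀ = Gs.headD 0 > 0`). -/
theorem logTerm_core {G : List ℚ} {w0 : ℚ} (hg0 : 0 < (taylorShift w0 G).headD 0) (s : ℤ) {δ : ℝ}
    (hG : 0 < qeval G ((w0 : ℝ) + δ)) :
    0 < 1 + qeval (relPoly (taylorShift w0 G)) δ ∧
      Real.log (qeval G ((w0 : ℝ) + δ)) ≤
        (logUBh ((taylorShift w0 G).headD 0) s : ℝ) + Real.log (1 + qeval (relPoly (taylorShift w0 G)) δ) := by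
  set Gs := taylorShift w0 G with hGs
  have hg0' : (0 : ℝ) < Gs.headD 0 := by exact_mod_cast hg0
  have hGval : qeval G ((w0 : ℝ) + δ) = (Gs.headD 0 : ℝ) * (1 + qeval (relPoly Gs) δ) := by
    rw [← qeval_taylorShift, ← hGs, qeval_relPoly Gs hg0.ne']
  have h1y : 0 < 1 + qeval (relPoly Gs) δ := by
    rw [hGval] at hG; exact pos_of_mul_pos_right hG hg0'.le
  refine ⟨h1y, ?_⟩
  rw [hGval, Real.log_mul hg0'.ne' h1y.ne']
  have := log_le_logUBh (Gs.headD 0) hg0 s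
  linarith

/-- Soundness of `logTermLB`. -/
theorem logTermLB_sound {G : List ℚ} {f w0 h : ℚ} {s : ℤ} {L : List ℚ} {K : ℚ}
    (hLK : logTermLB G f w0 h s = some (L, K)) {δ : ℝ} (hδ : |δ| ≤ (h : ℝ)) (hG : 0 < qeval G ((w0 : ℝ) + δ)) :
    qeval L δ + (K : ℝ) ≤ -(f : ℝ) * Real.log (qeval G ((w0 : ℝ) + δ)) := by
  unfold logTermLB at hLK
  simp only at hLK
  by_cases hpos : 0 < (taylorShift w0 G).headD 0 ∧ 0 ≤ f
  swap
  · rw [if_neg hpos] at hLK; simp at hLK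
  rw [if_pos hpos] at hLK
  obtain ⟨hg0, hf⟩ := hpos
  have hf' : (0 : ℝ) ≤ f := by exact_mod_cast hf
  obtain ⟨h1y, hlogG⟩ := logTerm_core hg0 s hG
  set Y := relPoly (taylorShift w0 G) with hY
  set g0 := (taylorShift w0 G).headD 0 with hg0def
  by_cases hη : absBound Y h ≤ 1 / 2
  · -- cubic mode
    rw [if_pos hη] at hLK
    simp only [Option.some.injEq, Prod.mk.injEq] at hLK
    obtain ⟨rfl, rfl⟩ := hLK
    have hηb : |qeval Y δ| ≤ (absBound Y h : ℝ) := abs_qeval_le_absBound Y hδ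
    have hη' : (absBound Y h : ℝ) ≤ 1 / 2 := by
      have := (Rat.cast_le (K := ℝ)).mpr hη; push_cast at this; exact this
    have hcub := log_one_add_le_cubic hηb hη'
    have hY0 : Y.headD 0 = 0 := by rw [hY, relPoly]; rfl
    have hsplit := qeval_zero_head Y hY0 δ
    set T := qeval (Y.drop 2) δ with hT
    have hh : (0 : ℝ) ≤ h := (abs_nonneg δ).trans hδ
    have hTb : |δ ^ 2 * T| ≤ (h : ℝ) ^ 2 * (absBound (Y.drop 2) h : ℝ) := by
      rw [abs_mul, abs_pow]
      exact mul_le_mul (pow_le_pow_left₀ (abs_nonneg δ) hδ 2) (abs_qeval_le_absBound _ hδ) (abs_nonneg _)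
        (pow_nonneg hh 2)
    have hsq : ((Y.getD 1 0 : ℚ) : ℝ) ^ 2 * δ ^ 2 -
        2 * |((Y.getD 1 0 : ℚ) : ℝ)| * h * ((h : ℝ) ^ 2 * (absBound (Y.drop 2) h : ℝ)) ≤ (qeval Y δ) ^ 2 := by
      rw [hsplit]
      have hcross : |((Y.getD 1 0 : ℚ) : ℝ) * δ * (δ ^ 2 * T)| ≤
          |((Y.getD 1 0 : ℚ) : ℝ)| * h * ((h : ℝ) ^ 2 * (absBound (Y.drop 2) h : ℝ)) := by
        rw [abs_mul, abs_mul]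
        exact mul_le_mul (mul_le_mul_of_nonneg_left hδ (abs_nonneg _)) hTb (abs_nonneg _)
          (mul_nonneg (abs_nonneg _) hh)
      have h3 := (abs_le.mp hcross).1
      nlinarith [sq_nonneg (δ ^ 2 * T)]
    rw [qeval_lAdd, qeval_lSMul, qeval_cons, qeval_cons, qeval_cons, qeval_nil, qabs_eq_abs]
    push_cast
    have h3 := mul_le_mul_of_nonneg_left hcub hf'
    have h4 := mul_le_mul_of_nonneg_left hsq (by positivity : (0 : ℝ) ≤ f / 2)
    have h5 := mul_le_mul_of_nonneg_left hlogG hf'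
    nlinarith [h3, h4, h5]
  · -- linear mode
    rw [if_neg hη] at hLK
    simp only [Option.some.injEq, Prod.mk.injEq] at hLK
    obtain ⟨rfl, rfl⟩ := hLK
    have hlin : Real.log (1 + qeval Y δ) ≤ qeval Y δ := by
      have := Real.log_le_sub_one_of_pos h1y; linarith
    rw [qeval_lSMul]
    push_cast
    have h3 := mul_le_mul_of_nonneg_left hlin hf'
    have h5 := mul_le_mul_of_nonneg_left hlogG hf'
    nlinarith [h5, h3]

/-! ## A cell, a segment, the circle -/

/-- The lower-bound data `(L, K)` of a whole cell: `P(w₀ + δ) - Σ_g f_g log G_g(w₀ + δ) ≥ L(δ) + K` on `|δ| ≤ h`. -/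
def cellPoly (P : List ℚ) (w0 h : ℚ) : List (List ℚ × ℚ) → List ℤ → Option (List ℚ × ℚ)
  | [], _ => some (taylorShift w0 P, 0)
  | g :: gs, hints =>
    match logTermLB g.1 g.2 w0 h (hints.headD 0), cellPoly P w0 h gs hints.tail with
    | some (L1, K1), some (L, K) => some (lAdd L1 L, K1 + K)
    | _, _ => none

/-- Soundness of `cellPoly`. -/
theorem cellPoly_sound (P : List ℚ) (w0 h : ℚ) : ∀ (gs : List (List ℚ × ℚ)) (hints : List ℤ) {L : List ℚ} {K : ℚ},
    cellPoly P w0 h gs hints = some (L, K) → ∀ {δ : ℝ}, |δ| ≤ (h : ℝ) → (∀ g ∈ gs, 0 < qeval g.1 ((w0 : ℝ) + δ)) →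
      qeval L δ + (K : ℝ) ≤ qeval P ((w0 : ℝ) + δ) -
        (gs.map fun g => ((g.2 : ℚ) : ℝ) * Real.log (qeval g.1 ((w0 : ℝ) + δ))).sum
  | [], hints, L, K, hLK, δ, hδ, _ => by
    simp only [cellPoly, Option.some.injEq, Prod.mk.injEq] at hLK
    obtain ⟨rfl, rfl⟩ := hLK
    simp [qeval_taylorShift]
  | g :: gs, hints, L, K, hLK, δ, hδ, hpos => by
    simp only [cellPoly] at hLK
    split at hLK
    · rename_i L1 K1 L' K' h1 h2
      simp only [Option.some.injEq, Prod.mk.injEq] at hLK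
      obtain ⟨rfl, rfl⟩ := hLK
      have ht := logTermLB_sound h1 hδ (hpos g (List.mem_cons_self))
      have hr := cellPoly_sound P w0 h gs hints.tail h2 hδ (fun g' hg' => hpos g' (List.mem_cons_of_mem _ hg'))
      rw [qeval_lAdd, List.map_cons, List.sum_cons]
      push_cast
      linarith
    · simp at hLK

/-- Boolean check of one cell `(w₀, h, hints)` against the bound `-m`. -/
def cellCheck (P : List ℚ) (gs : List (List ℚ × ℚ)) (m : ℚ) (c : ℚ × ℚ × List ℤ) : Bool :=
  match cellPoly P c.1 c.2.1 gs c.2.2 with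
  | none => false
  | some (L, K) => decide (0 ≤ c.2.1) && decide (-m ≤ polyLB L c.2.1 + K)

/-- Soundness of `cellCheck`: the claim holds on the cell. -/
theorem cellCheck_sound {P : List ℚ} {gs : List (List ℚ × ℚ)} {m : ℚ} {c : ℚ × ℚ × List ℤ}
    (hc : cellCheck P gs m c = true) {w : ℝ} (hw : |w - (c.1 : ℝ)| ≤ (c.2.1 : ℝ)) (hpos : ∀ g ∈ gs, 0 < qeval g.1 w) :
    -(m : ℝ) ≤ qeval P w - (gs.map fun g => ((g.2 : ℚ) : ℝ) * Real.log (qeval g.1 w)).sum := by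
  unfold cellCheck at hc
  split at hc
  · simp at hc
  · rename_i L K hLK
    simp only [Bool.and_eq_true, decide_eq_true_eq] at hc
    obtain ⟨_, hm⟩ := hc
    have hwδ : w = (c.1 : ℝ) + (w - c.1) := by ring
    rw [hwδ] at hpos ⊢
    have h1 := cellPoly_sound P c.1 c.2.1 gs c.2.2 hLK hw hpos
    have h2 := polyLB_le L c.2.1 hw
    have hm' : (-(m : ℚ) : ℝ) ≤ ((polyLB L c.2.1 + K : ℚ) : ℝ) := by exact_mod_cast hm
    push_cast at hm'
    linarith

/-- The claim on a segment `[lo, hi]`. -/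
def SegClaim (P : List ℚ) (gs : List (List ℚ × ℚ)) (m lo hi : ℚ) : Prop :=
  ∀ w : ℝ, (lo : ℝ) ≤ w → w ≤ (hi : ℝ) → (∀ g ∈ gs, 0 < qeval g.1 w) →
    -(m : ℝ) ≤ qeval P w - (gs.map fun g => ((g.2 : ℚ) : ℝ) * Real.log (qeval g.1 w)).sum

/-- Segments concatenate. -/
theorem segClaim_append {P : List ℚ} {gs : List (List ℚ × ℚ)} {m lo mid hi : ℚ} (h1 : SegClaim P gs m lo mid)
    (h2 : SegClaim P gs m mid hi) : SegClaim P gs m lo hi := by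
  intro w hlo hhi hpos
  rcases le_or_gt w (mid : ℝ) with h | h
  · exact h1 w hlo h hpos
  · exact h2 w h.le hhi hpos

/-- The circle claim is the segment `[-2, 2]`. -/
theorem circleClaim_of_segClaim {P : List ℚ} {gs : List (List ℚ × ℚ)} {m : ℚ} (h : SegClaim P gs m (-2) 2) :
    CircleClaim P gs m := by
  intro w h1 h2 hpos
  exact h w (by push_cast; linarith) (by push_cast; linarith) hpos

/-- The cells `(w₀, h, _)` cover `[a, hi]` (cells listed with increasing right end points). -/
def coverFrom (a hi : ℚ) : List (ℚ × ℚ × List ℤ) → Bool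
  | [] => false
  | c :: cs => decide (c.1 - c.2.1 ≤ a) && (decide (hi ≤ c.1 + c.2.1) || coverFrom (c.1 + c.2.1) hi cs)

/-- Soundness of `coverFrom`. -/
theorem coverFrom_sound : ∀ (cs : List (ℚ × ℚ × List ℤ)) (a hi : ℚ), coverFrom a hi cs = true →
    ∀ w : ℝ, (a : ℝ) ≤ w → w ≤ (hi : ℝ) → ∃ c ∈ cs, |w - (c.1 : ℝ)| ≤ (c.2.1 : ℝ)
  | [], a, hi, h, w, _, _ => by simp [coverFrom] at h
  | c :: cs, a, hi, h, w, ha, hhi => by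
    simp only [coverFrom, Bool.and_eq_true, Bool.or_eq_true, decide_eq_true_eq] at h
    obtain ⟨hleft, hrest⟩ := h
    have hleft' : ((c.1 - c.2.1 : ℚ) : ℝ) ≤ (a : ℝ) := by exact_mod_cast hleft
    push_cast at hleft'
    by_cases hwc : w ≤ (c.1 : ℝ) + c.2.1
    · exact ⟨c, List.mem_cons_self, abs_le.mpr ⟨by linarith, by linarith⟩⟩
    · push Not at hwc
      rcases hrest with hend | hcov
      · have : ((hi : ℚ) : ℝ) ≤ ((c.1 + c.2.1 : ℚ) : ℝ) := by exact_mod_cast hend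
        push_cast at this; linarith
      · obtain ⟨c', hc', hwc'⟩ := coverFrom_sound cs (c.1 + c.2.1) hi hcov w (by push_cast; exact hwc.le) hhi
        exact ⟨c', List.mem_cons_of_mem _ hc', hwc'⟩

/-- Boolean check of a segment: the cells cover `[lo, hi]` and each cell passes. -/
def segCheck (P : List ℚ) (gs : List (List ℚ × ℚ)) (m lo hi : ℚ) (cells : List (ℚ × ℚ × List ℤ)) : Bool :=
  coverFrom lo hi cells && cells.all (cellCheck P gs m)

/-- **Soundness of the segment checker.** -/
theorem segClaim_of_segCheck {P : List ℚ} {gs : List (List ℚ × ℚ)} {m lo hi : ℚ} {cells : List (ℚ × ℚ × List ℤ)}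
    (h : segCheck P gs m lo hi cells = true) : SegClaim P gs m lo hi := by
  unfold segCheck at h
  simp only [Bool.and_eq_true, List.all_eq_true] at h
  obtain ⟨hcov, hall⟩ := h
  intro w hlo hhi hpos
  obtain ⟨c, hc, hwc⟩ := coverFrom_sound cells lo hi hcov w hlo hhi
  exact cellCheck_sound (hall c hc) hwc hpos

/-- **Soundness of the circle checker:** a checked certificate over `[-2, 2]` proves the circle claim. -/
theorem circleClaim_of_segCheck {P : List ℚ} {gs : List (List ℚ × ℚ)} {m : ℚ} {cells : List (ℚ × ℚ × List ℤ)}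
    (h : segCheck P gs m (-2) 2 cells = true) : CircleClaim P gs m :=
  circleClaim_of_segClaim (segClaim_of_segCheck h)

/-! ## Kernel smoke test -/

/-- `-1/2 ≤ w²/4 - (1/10)·log(3 + w)` on `[-2, 2]` from three cells (kernel `decide`, no `native_decide`). -/
example : segCheck [0, 0, 1 / 4] [([3, 1], 1 / 10)] (1 / 2) (-2) 2
    [(-1, 1, [3]), (1 / 2, 1 / 2, [6]), (3 / 2, 1 / 2, [7])] = true := by
  decide +kernel

end Summit.Ventures.DiscreteObjects.Mahler
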